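import Mathlib.Analysis.InnerProductSpace.Orthogonal
import Mathlib.Analysis.InnerProductSpace.Projection.FiniteDimensional
import Mathlib.MeasureTheory.Measure.Haar.InnerProductSpace
import Mathlib.MeasureTheory.Integral.IntervalIntegral.Basic
import Mathlib.Analysis.Distribution.SchwartzSpace.Basic
import Mathlib.Analysis.Fourier.AddCircleMulti
import Mathlib.Probability.Independence.Basic
import Mathlib.Probability.Distributions.Gaussian.Real
import Literature.Analysis.FunctionSpaces.FlatTorus
import Literature.Analysis.FunctionSpaces.TorusCalculus
import Literature.Analysis.FunctionSpaces.TorusSobolevNorm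
import HarnessLib

-- provenance: harness21/H21/H21/Prelude/FluidKinetic/WaveKinetic.lean @ 6264bac (interim HEAD d8f2665); M5 mechanical rewrite
/-!
# The wave kinetic equation and its NLS microscopic model
(trunk: FluidKinetic / T-KINETIC, item K7 `WaveKinetic`, notion `wave_kinetic_equation`)

This file states, in Mathlib style, the objects entering the rigorous derivation of the
(four-wave, cubic) *wave kinetic equation* (WKE) from the cubic nonlinear Schrödinger equation
with random data (Deng–Hani).

## The kinetic side (`E` a finite-dimensional real inner product space, `k ∈ E`)

The WKE reads `∂ₜ n(t, k) = 𝒦(n(t))(k)` with (Deng–Hani 2021, (KWE); Nazarenko 2011, (6.81))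

  `𝒦(n)(k) = ∫_{k₁ - k₂ + k₃ = k} n n₁ n₂ n₃ (1/n − 1/n₁ + 1/n₂ − 1/n₃) δ(|k₁|² − |k₂|² + |k₃|² − |k|²)`.

* `WaveKinetic.cubicForm n k k₁ k₂ k₃` is the integrand written as a polynomial (no inverses).
* `WaveKinetic.collision n k` resolves the two delta functions: with `k₁ = k + a`, `k₃ = k + b`,
  `k₂ = k + a + b` the momentum constraint is automatic and the resonance function is
  `Ω = |k+a|² − |k+a+b|² + |k+b|² − |k|² = −2⟪a, b⟫`; for `a ≠ 0` the coarea formula turns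
  `δ(Ω) db` into the Lebesgue (Hausdorff) measure of the hyperplane `(ℝ ∙ a)ᗮ` divided by
  `|∇_b Ω| = 2‖a‖`. The hyperplane measure is Mathlib's `volume` on the inner product space
  `↥(ℝ ∙ a)ᗮ` (`measureSpaceOfInnerProductSpace`).
* `WaveKinetic.WKEIntegrable`, `WaveKinetic.IsWKESolutionOn`, `WaveKinetic.IsMildWKESolutionOn`,
  `WaveKinetic.rayleighJeans` (the formal equilibria `(μ + β|k|² + γ·k)⁻¹`).

## The microscopic side (the unit torus `UnitAddTorus d`)

Deng–Hani work on the torus of size `L`; we rescale space to the unit torus `T^d = (ℝ/ℤ)^d`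
(G03's `UnitAddTorus d`, calculus from `Literature.Torus`), so that the dispersion coefficient becomes a
parameter `β` (of `(2π L)⁻²`-type, supplied by the statement files) and lattice modes are
`k ∈ ℤ^d`, corresponding to the physical wave number `k / L`.

* `WaveKinetic.IsCubicNLSOn S β α u`: `u` is smooth on `S × T^d` and
  `i ∂ₜu − β Δu + α |u|² u = 0` there; `WaveKinetic.nlsMass`, `WaveKinetic.nlsEnergy`.
* Random data: `WaveKinetic.IsRandomPhaseFamily P η` (independent, rotation-invariant laws,
  `𝔼|η_k|² = 1`), `WaveKinetic.IsGaussianPhaseFamily`, `WaveKinetic.randomData L nin η ω`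
  (`∑_k √(nin(k/L)) η_k(ω) e^{2πi k·x}`), `WaveKinetic.modeEnergy P u t k = 𝔼 |û(t, k)|²`,
  `WaveKinetic.kineticTime α`.

## Theorems

Proved: `cubicForm_rayleighJeans_eq_zero`, `collision_rayleighJeans_eq_zero` (Rayleigh–Jeans
equilibria; the integrand vanishes pointwise on the resonant manifold), `kineticTime_nonneg`.
Bold titles on theorems below are descriptive, not inventory ids (this prelude file has none).
Known in print, proofs `sorry`: `IsWKESolutionOn.mass_conserved`,
`IsWKESolutionOn.energy_conserved`, `exists_isWKESolutionOn_local`, `IsCubicNLSOn.nlsMass_eq`,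
`modeEnergy_randomData_zero`.

## Mathlib search

Mathlib has no wave kinetic equation, no NLS, no random Fourier data (`rg` for `kinetic`,
`Schrodinger`, `NLS`, `randomFourier` in `Mathlib/` returns nothing relevant). Used anchors:
`Submodule.span`/`ᗮ` + `volume` on a submodule of an inner product space,
`UnitAddTorus.mFourier`/`mFourierCoeff` (`Analysis/Fourier/AddCircleMulti`),
`ProbabilityTheory.iIndepFun`, `ProbabilityTheory.gaussianReal`, `Measure.map`,
`HasDerivWithinAt`, `intervalIntegral`, `SchwartzMap`.

## Design choices and flagged constants ('?')

* The overall constant in front of `collision` relative to Deng–Hani's (KWE) is **not** verified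
  ('?'); likewise `kineticTime α = α⁻²` is Deng–Hani's `T_kin` only up to a numerical constant
  ('?', outline §4.9), the normalisation `L^{-d}`-type factor of `randomData` is absorbed into
  our unit-torus rescaling ('?': all `L`-dependence is to be put into `α`, `β` by the statement
  files), and the sign convention of the NLS is `(i∂ₜ − βΔ + α|u|²) u = 0`, which agrees with
  Deng–Hani's `(i∂ₜ − Δ) u + α|u|²u = 0` on `T^d_L` for `β = 1`.
* `IsWKESolutionOn` adds continuity in time (at each wave number) to the outline's
  right-derivative formulation, excluding jump "solutions"; `IsMildWKESolutionOn` carries an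
  `IntervalIntegrable` conjunct and lives on the closed interval `Icc 0 T`.
* Junk values: in `collision` the factor `(2‖a‖)⁻¹ = 0` at `a = 0` (a null set); the inner and
  outer Bochner integrals are `0` when divergent, whence the side predicate `WKEIntegrable`;
  `randomData` is a `tsum`, `0` if not summable (it is a.s. absolutely summable when
  `∑_k √(nin(k/L)) < ∞`, e.g. for Schwartz `nin ≥ 0`); `rayleighJeans` uses `x⁻¹` with `0⁻¹ = 0`,
  theorems assume the denominator is positive. In dimension `1` the hyperplane `(ℝ ∙ a)ᗮ` is `{0}`
  with Dirac volume and `‖a‖⁻¹` is not locally integrable, so the kernel is only meaningful for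
  `2 ≤ finrank ℝ E`; the `sorry`ed theorems are stated for `3 ≤ finrank ℝ E`, the setting of the
  cited sources (Deng–Hani: `d ≥ 3`).
* `Literature.Prelude.Sobolev.TorusSobolevNorm` is imported (though unused here) so that it is
  re-exported to `Statements/Hilbert6/WaveKinetic.lean`, which needs the torus `H^s` norms.
* `IsGaussianPhaseFamily` is phrased via `gaussianReal 0 (1/2)` marginals of `re`/`im` rather
  than Mathlib's `stdGaussian` on `ℂ ≃ ℝ²` (unit component variance there); equivalent given the
  rotation invariance in `IsRandomPhaseFamily`.

## References

* Y. Deng, Z. Hani, *On the derivation of the wave kinetic equation for NLS*, Forum Math. Pi 9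
  (2021), e6: (KWE), (1.1)–(1.4), Thm 1.1.
* Y. Deng, Z. Hani, *Full derivation of the wave kinetic equation*, J. Amer. Math. Soc. 36 (2023),
  Thm 1.1.
* S. Nazarenko, *Wave Turbulence*, LNP 825, Springer 2011, eq. (6.81).
-/

open MeasureTheory Set Topology ProbabilityTheory
open scoped InnerProductSpace ENNReal NNReal

namespace Literature.Analysis.FluidPDE

noncomputable section

namespace WaveKinetic

/-! ## The collision kernel on a Euclidean space -/

section Kernel

variable {E : Type*} [NormedAddCommGroup E] [InnerProductSpace ℝ E] [FiniteDimensional ℝ E]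
  [MeasurableSpace E] [BorelSpace E]

omit [FiniteDimensional ℝ E] [MeasurableSpace E] [BorelSpace E] in
/-- The cubic integrand of the four-wave kinetic equation,
`n₁ n₂ n₃ − n n₂ n₃ + n n₁ n₃ − n n₁ n₂ = n n₁ n₂ n₃ (1/n − 1/n₁ + 1/n₂ − 1/n₃)` where
`n = n(k)`, `nᵢ = n(kᵢ)`, written as a polynomial so that no inverse (and no junk value) occurs
(Deng–Hani, Forum Math. Pi 9 (2021), (KWE); Nazarenko 2011, (6.81)). [claim: DengHaniMa2024, status: under-review] -/
def cubicForm (n : E → ℝ) (k k₁ k₂ k₃ : E) : ℝ :=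
  n k₁ * n k₂ * n k₃ - n k * n k₂ * n k₃ + n k * n k₁ * n k₃ - n k * n k₁ * n k₂

/-- The collision operator `𝒦(n)(k)` of the cubic wave kinetic equation,
`∫_{k₁−k₂+k₃=k} n n₁ n₂ n₃ (1/n − 1/n₁ + 1/n₂ − 1/n₃) δ(|k₁|² − |k₂|² + |k₃|² − |k|²)`, with the
resonant manifold parametrised by `k₁ = k + a`, `k₃ = k + b`, `k₂ = k + a + b` (so
`Ω = −2⟪a, b⟫`) and `δ(Ω) db` resolved by the coarea formula as the hyperplane measure `volume`
on `(ℝ ∙ a)ᗮ` divided by `|∇_b Ω| = 2‖a‖` (Deng–Hani, Forum Math. Pi 9 (2021), (KWE) and (1.3);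
Nazarenko 2011, (6.81)). The overall multiplicative constant relative to Deng–Hani is not
verified ('?'). Junk: the factor `(2‖a‖)⁻¹` is `0` at `a = 0` (a null set); both Bochner
integrals are `0` when divergent (see `WKEIntegrable`). [claim: DengHaniMa2024, status: under-review] -/
def collision (n : E → ℝ) (k : E) : ℝ :=
  ∫ a : E, (2 * ‖a‖)⁻¹ * ∫ b : ↥(ℝ ∙ a)ᗮ, cubicForm n k (k + a) (k + a + (b : E)) (k + (b : E))

/-- Absolute convergence of the iterated collision integral `collision n k` at the wave number
`k`: for a.e. `a` the hyperplane integral converges absolutely, the resulting function of `a`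
(weighted by `(2‖a‖)⁻¹`, with absolute values inside) is integrable, and the signed outer
integrand of `collision n k` is itself integrable (in particular a.e.-strongly measurable, which
does not follow from the absolute-value condition), so that neither Bochner integral in
`collision n k` takes its junk value (Deng–Hani, Forum Math. Pi 9 (2021), §1, well-posedness
discussion after (KWE)). [claim: DengHaniMa2024, status: under-review] -/
def WKEIntegrable (n : E → ℝ) (k : E) : Prop :=
  (∀ᵐ a : E, Integrable (fun b : ↥(ℝ ∙ a)ᗮ => cubicForm n k (k + a) (k + a + (b : E)) (k + b))) ∧
    Integrable (fun a : E =>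
      (2 * ‖a‖)⁻¹ * ∫ b : ↥(ℝ ∙ a)ᗮ, |cubicForm n k (k + a) (k + a + (b : E)) (k + (b : E))|) ∧
    Integrable (fun a : E =>
      (2 * ‖a‖)⁻¹ * ∫ b : ↥(ℝ ∙ a)ᗮ, cubicForm n k (k + a) (k + a + (b : E)) (k + (b : E)))

/-- `n : ℝ → E → ℝ` is a (classical, forward-in-time) solution of the wave kinetic equation
`∂ₜ n = 𝒦(n)` on the time interval `[0, T)`: at every wave number `k`, `t ↦ n t k` is continuous
on `[0, T)`, and at every time `t ∈ [0, T)` the collision integral converges absolutely and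
`s ↦ n s k` has right derivative `collision (n t) k` at `t` (Deng–Hani, Forum Math. Pi 9 (2021),
(KWE); J. Amer. Math. Soc. 36 (2023), (WKE)). Design: the continuity conjunct is added to the
outline's right-derivative formulation, which alone would admit jump "solutions" (e.g. switching
between two Rayleigh–Jeans spectra, cf. `collision_rayleighJeans_eq_zero`). [claim: DengHaniMa2024, status: under-review] -/
def IsWKESolutionOn (T : ℝ) (n : ℝ → E → ℝ) : Prop :=
  ∀ k, ContinuousOn (fun t => n t k) (Ico 0 T) ∧ ∀ t ∈ Ico (0 : ℝ) T,
    WKEIntegrable (n t) k ∧ HasDerivWithinAt (fun s => n s k) (collision (n t) k) (Ici t) t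

/-- `n : ℝ → E → ℝ` is a mild (Duhamel/integral-form) solution of the wave kinetic equation on
the closed interval `[0, T]` (Deng–Hani solve the WKE on `[0, δ]`, whence `Icc` here as opposed
to the half-open `Ico 0 T` of the classical notion `IsWKESolutionOn`):
`n(t, k) = n(0, k) + ∫₀ᵗ 𝒦(n(s))(k) ds` for all `k` and `t ∈ [0, T]`, with absolutely convergent
collision integrals and with `s ↦ 𝒦(n(s))(k)` interval-integrable on `[0, t]` (so that the
interval integral is not the junk `0`; same convention as `Kinetic.IsMildBoltzmannSolutionOn`)
(Deng–Hani, J. Amer. Math. Soc. 36 (2023), Thm 1.1 and (WKE)). [claim: DengHaniMa2024, status: under-review] -/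
def IsMildWKESolutionOn (T : ℝ) (n : ℝ → E → ℝ) : Prop :=
  ∀ k, ∀ t ∈ Icc (0 : ℝ) T,
    WKEIntegrable (n t) k ∧ IntervalIntegrable (fun s => collision (n s) k) volume 0 t ∧
      n t k = n 0 k + ∫ s in (0 : ℝ)..t, collision (n s) k

omit [FiniteDimensional ℝ E] [MeasurableSpace E] [BorelSpace E] in
/-- The Rayleigh–Jeans spectra `n(k) = (μ + β|k|² + ⟪γ, k⟫)⁻¹`, the formal equilibria of the
four-wave kinetic equation (mass `μ`, energy `β` and momentum `γ` Lagrange multipliers)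
(Nazarenko 2011, §9.1 / (6.81); Deng–Hani, Forum Math. Pi 9 (2021), §1). Junk: `0⁻¹ = 0` where
the denominator vanishes; theorems assume it is positive. [claim: DengHaniMa2024, status: under-review] -/
def rayleighJeans (μ β : ℝ) (γ : E) (k : E) : ℝ :=
  (μ + β * ‖k‖ ^ 2 + ⟪γ, k⟫_ℝ)⁻¹

omit [FiniteDimensional ℝ E] [MeasurableSpace E] [BorelSpace E] in
/-- On the resonant manifold the Rayleigh–Jeans integrand vanishes pointwise: for `b ⊥ a`,
`cubicForm (rayleighJeans μ β γ) k (k+a) (k+a+b) (k+b) = 0`, because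
`1/n − 1/n₁ + 1/n₂ − 1/n₃ = β(|k|² − |k+a|² + |k+a+b|² − |k+b|²) = 2β⟪a,b⟫ = 0`
(Nazarenko 2011, §9.1). [cite: Nazarenko2011, §9.1] -/
theorem cubicForm_rayleighJeans_eq_zero (μ β : ℝ) (γ : E)
    (hpos : ∀ k, 0 < μ + β * ‖k‖ ^ 2 + ⟪γ, k⟫_ℝ) (k a b : E) (hab : ⟪a, b⟫_ℝ = 0) :
    cubicForm (rayleighJeans μ β γ) k (k + a) (k + a + b) (k + b) = 0 := by
  unfold cubicForm rayleighJeans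
  have key : (μ + β * ‖k‖ ^ 2 + ⟪γ, k⟫_ℝ) - (μ + β * ‖k + a‖ ^ 2 + ⟪γ, k + a⟫_ℝ)
      + (μ + β * ‖k + a + b‖ ^ 2 + ⟪γ, k + a + b⟫_ℝ) - (μ + β * ‖k + b‖ ^ 2 + ⟪γ, k + b⟫_ℝ)
      = 0 := by
    have hba : ⟪b, a⟫_ℝ = 0 := by rw [real_inner_comm]; exact hab
    simp only [← real_inner_self_eq_norm_sq, inner_add_left, inner_add_right, hab, hba]
    ring
  have h0 := hpos k; have h1 := hpos (k + a); have h2 := hpos (k + a + b); have h3 := hpos (k + b)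
  generalize μ + β * ‖k‖ ^ 2 + ⟪γ, k⟫_ℝ = p0 at *
  generalize μ + β * ‖k + a‖ ^ 2 + ⟪γ, k + a⟫_ℝ = p1 at *
  generalize μ + β * ‖k + a + b‖ ^ 2 + ⟪γ, k + a + b⟫_ℝ = p2 at *
  generalize μ + β * ‖k + b‖ ^ 2 + ⟪γ, k + b⟫_ℝ = p3 at *
  have : p1⁻¹ * p2⁻¹ * p3⁻¹ - p0⁻¹ * p2⁻¹ * p3⁻¹ + p0⁻¹ * p1⁻¹ * p3⁻¹ - p0⁻¹ * p1⁻¹ * p2⁻¹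
      = (p0 - p1 + p2 - p3) * (p0⁻¹ * p1⁻¹ * p2⁻¹ * p3⁻¹) := by
    field_simp
  rw [this, key, zero_mul]

/-- The Rayleigh–Jeans spectra are stationary solutions of the wave kinetic equation:
`𝒦((μ + β|k|² + γ·k)⁻¹) = 0` (formally; here even pointwise on the resonant manifold, so no
integrability is needed) (Nazarenko 2011, §9.1; Deng–Hani, Forum Math. Pi 9 (2021), §1). [claim: DengHaniMa2024, status: under-review] -/
theorem collision_rayleighJeans_eq_zero (μ β : ℝ) (γ : E)
    (hpos : ∀ k, 0 < μ + β * ‖k‖ ^ 2 + ⟪γ, k⟫_ℝ) (k : E) :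
    collision (rayleighJeans μ β γ) k = 0 := by
  unfold collision
  have hinner : ∀ a : E, (∫ b : ↥(ℝ ∙ a)ᗮ, cubicForm (rayleighJeans μ β γ) k (k + a)
      (k + a + (b : E)) (k + (b : E))) = 0 := by
    intro a
    refine integral_eq_zero_of_ae (Filter.Eventually.of_forall fun b => ?_)
    exact cubicForm_rayleighJeans_eq_zero μ β γ hpos k a b
      ((Submodule.mem_orthogonal_singleton_iff_inner_right (𝕜 := ℝ)).mp b.2)
  simp [hinner]

/-- Uniform polynomial decay of a time-dependent spectrum on `[0, T)`:
`|n(t, k)| ≤ C ⟨k⟩^{-s}` for all `t ∈ [0, T)` and `k`. This is the weighted-`L^∞` class in which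
Deng–Hani solve the wave kinetic equation locally (Forum Math. Pi 9 (2021), Thm 1.1 setting;
J. Amer. Math. Soc. 36 (2023), Thm 1.1). [claim: DengHaniMa2024, status: under-review] -/
def HasUniformDecayOn (T s : ℝ) (n : ℝ → E → ℝ) : Prop :=
  ∃ C : ℝ, ∀ t ∈ Ico (0 : ℝ) T, ∀ k, |n t k| ≤ C * (1 + ‖k‖) ^ (-s)

/-- **Conservation of mass (wave action)** for the wave kinetic equation: a solution on `[0, T)`
(continuous in time at each wave number, by definition) with uniform polynomial decay of order
`s > dim E`, in dimension `≥ 3` (the setting of the cited sources), satisfies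
`∫ n(t, k) dk = ∫ n(0, k) dk` (Nazarenko 2011, §6; Deng–Hani, Forum Math. Pi 9 (2021), §1).
The decay hypotheses are sufficient, not sharp. [claim: DengHaniMa2024, status: under-review] -/
def IsWKESolutionOn.mass_conserved : Prop :=
  ∀ {T s : ℝ} {n : ℝ → E → ℝ} (hn : IsWKESolutionOn T n) (hE : 3 ≤ Module.finrank ℝ E) (hs : (Module.finrank ℝ E : ℝ) < s) (hdecay : HasUniformDecayOn T s n) (hmeas : ∀ t ∈ Ico (0 : ℝ) T, Measurable (n t)) {t : ℝ} (ht : t ∈ Ico (0 : ℝ) T),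
    ∫ k, n t k = ∫ k, n 0 k

/-- **Conservation of energy** for the wave kinetic equation: under the hypotheses of
`IsWKESolutionOn.mass_conserved` (dimension `≥ 3`) with decay order `s > dim E + 2`,
`∫ |k|² n(t, k) dk = ∫ |k|² n(0, k) dk` (Nazarenko 2011, §6; Deng–Hani, Forum Math. Pi 9 (2021),
§1). The decay hypotheses are sufficient, not sharp. [claim: DengHaniMa2024, status: under-review] -/
def IsWKESolutionOn.energy_conserved : Prop :=
  ∀ {T s : ℝ} {n : ℝ → E → ℝ} (hn : IsWKESolutionOn T n) (hE : 3 ≤ Module.finrank ℝ E) (hs : (Module.finrank ℝ E : ℝ) + 2 < s) (hdecay : HasUniformDecayOn T s n) (hmeas : ∀ t ∈ Ico (0 : ℝ) T, Measurable (n t)) {t : ℝ} (ht : t ∈ Ico (0 : ℝ) T),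
    ∫ k, ‖k‖ ^ 2 * n t k = ∫ k, ‖k‖ ^ 2 * n 0 k

/-- **Local well-posedness of the wave kinetic equation** for Schwartz, nonnegative initial data
in dimension `≥ 3` (the setting of the cited sources): there is `T > 0` and a solution `n` of
`∂ₜ n = 𝒦(n)` on `[0, T)` with `n(0) = n_in` (continuous in time, by definition of
`IsWKESolutionOn`) with uniform polynomial decay of every order
(Deng–Hani, Forum Math. Pi 9 (2021), §1 (well-posedness of (KWE), Prop. '?');
J. Amer. Math. Soc. 36 (2023), Thm 1.1 (existence of the WKE solution on `[0, δ]`)). [claim: DengHaniMa2024, status: under-review] -/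
def exists_isWKESolutionOn_local : Prop :=
  ∀ (hE : 3 ≤ Module.finrank ℝ E) (nin : SchwartzMap E ℝ) (hnonneg : ∀ k, 0 ≤ nin k),
    ∃ T : ℝ, 0 < T ∧ ∃ n : ℝ → E → ℝ, n 0 = nin ∧ IsWKESolutionOn T n ∧
      ∀ s : ℝ, HasUniformDecayOn T s n

end Kernel

/-! ## The cubic NLS on the unit torus -/

section NLS

variable {d : Type*} [Fintype d] [DecidableEq d]

omit [DecidableEq d] in
/-- `u : ℝ → T^d → ℂ` is a smooth solution of the cubic nonlinear Schrödinger equation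
`i ∂ₜu − β Δu + α |u|² u = 0` on the time set `S` (typically `Icc 0 T`): `u` is jointly smooth on
`S × T^d` (`Torus.IsSmoothSpaceTimeOn`) and the equation holds pointwise, with the one-sided time
derivative `Torus.timeDerivWithin S` and G03's `Torus.laplacian`. Here `β` is the dispersion
coefficient produced by rescaling Deng–Hani's torus `T^d_L` to the unit torus (of `(2πL)⁻²`-type,
supplied by the statements) and `α` the nonlinearity strength (Deng–Hani, Forum Math. Pi 9 (2021),
(1.1) (NLS); J. Amer. Math. Soc. 36 (2023), (NLS)). Sign convention: `(i∂ₜ − βΔ + α|u|²)u = 0`,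
which is Deng–Hani's (defocusing) `(i∂ₜ − Δ)u + α|u|²u = 0` with `β = 1`. Normalisation: `α` is
the nonlinearity strength in the normalisation in which `randomData` has `O(1)` mode energies
(`modeEnergy_randomData_zero`); the `L`-dependence coming from Deng–Hani's `L^{-d/2}`-normalised
data on `T^d_L` must therefore be put into `α` (and `β`) by the statement files. [claim: DengHaniMa2024, status: under-review] -/
def IsCubicNLSOn (S : Set ℝ) (β α : ℝ) (u : ℝ → UnitAddTorus d → ℂ) : Prop :=
  FunctionSpaces.Torus.IsSmoothSpaceTimeOn S u ∧
    ∀ t ∈ S, ∀ x, Complex.I * FunctionSpaces.Torus.timeDerivWithin S u t x - (β : ℂ) * FunctionSpaces.Torus.laplacian (u t) x +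
      ((α * ‖u t x‖ ^ 2 : ℝ) : ℂ) * u t x = 0

omit [DecidableEq d] in
/-- The mass `M(u) = ∫_{T^d} |u(x)|² dx` of a field on the unit torus, conserved by the cubic NLS
(Deng–Hani, Forum Math. Pi 9 (2021), §1.1). Junk: Bochner integral, `0` if not integrable. [claim: DengHaniMa2024, status: under-review] -/
def nlsMass (u : UnitAddTorus d → ℂ) : ℝ :=
  ∫ x, ‖u x‖ ^ 2

/-- The Hamiltonian `H(u) = ∫_{T^d} (β/2) |∇u|² + (α/4) |u|⁴ dx` of the cubic NLS
`i∂ₜu − βΔu + α|u|²u = 0` on the unit torus, with `|∇u|² = ∑ᵢ |∂ᵢu|²` via G03's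
`Torus.partialDeriv` (Deng–Hani, Forum Math. Pi 9 (2021), §1.1; standard). Junk: Bochner
integral, `0` if not integrable. [claim: DengHaniMa2024, status: under-review] -/
def nlsEnergy (β α : ℝ) (u : UnitAddTorus d → ℂ) : ℝ :=
  ∫ x, (β / 2) * ∑ i, ‖FunctionSpaces.Torus.partialDeriv i u x‖ ^ 2 + (α / 4) * ‖u x‖ ^ 4

omit [DecidableEq d] in
/-- **Mass conservation for the cubic NLS**: a smooth solution on `[0, T]` satisfies
`∫ |u(t)|² = ∫ |u(0)|²` for `t ∈ [0, T]` (multiply the equation by `ū`, take imaginary parts and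
integrate by parts on the torus; Deng–Hani, Forum Math. Pi 9 (2021), §1.1; standard). [claim: DengHaniMa2024, status: under-review] -/
def IsCubicNLSOn.nlsMass_eq : Prop :=
  ∀ {T β α : ℝ} {u : ℝ → UnitAddTorus d → ℂ} (hu : IsCubicNLSOn (Icc 0 T) β α u) {t : ℝ} (ht : t ∈ Icc (0 : ℝ) T),
    nlsMass (u t) = nlsMass (u 0)

end NLS

/-! ## Random data and mode energies -/

section Random

variable {d : Type*} [Fintype d]
variable {Ω : Type*} [MeasurableSpace Ω]

/-- A family `η = (η_k)_{k ∈ ℤ^d}` of complex random variables is a *random phase family*: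
the `η_k` are measurable, mutually independent (`ProbabilityTheory.iIndepFun`), each law is
invariant under phase rotations `η_k ↦ e^{iθ} η_k`, and normalised by `𝔼 |η_k|² = 1`. This covers
both of Deng–Hani's choices: `η_k` uniform on the unit circle, or standard complex Gaussian
(Deng–Hani, Forum Math. Pi 9 (2021), (1.2) and the paragraph after it; J. Amer. Math. Soc. 36
(2023), §1.1). [claim: DengHaniMa2024, status: under-review] -/
def IsRandomPhaseFamily (P : Measure Ω) (η : (d → ℤ) → Ω → ℂ) : Prop :=
  (∀ k, Measurable (η k)) ∧ iIndepFun η P ∧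
    ∀ k, (∀ θ : ℝ, P.map (fun ω => Complex.exp (θ * Complex.I) * η k ω) = P.map (η k)) ∧
      ∫ ω, ‖η k ω‖ ^ 2 ∂P = 1

/-- A *Gaussian* random phase family: a random phase family whose members are standard complex
Gaussians, i.e. `re η_k` and `im η_k` have law `N(0, 1/2)` (`ProbabilityTheory.gaussianReal`);
together with rotation invariance this determines the standard complex Gaussian law
(Deng–Hani, Forum Math. Pi 9 (2021), after (1.2); J. Amer. Math. Soc. 36 (2023), §1.1). [claim: DengHaniMa2024, status: under-review] -/
def IsGaussianPhaseFamily (P : Measure Ω) (η : (d → ℤ) → Ω → ℂ) : Prop :=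
  IsRandomPhaseFamily P η ∧
    ∀ k, P.map (fun ω => (η k ω).re) = gaussianReal 0 ((2 : ℝ≥0)⁻¹) ∧
      P.map (fun ω => (η k ω).im) = gaussianReal 0 ((2 : ℝ≥0)⁻¹)

variable [DecidableEq d]

/-- Deng–Hani's *well-prepared random initial data*, rescaled to the unit torus:
`u_in(ω, x) = ∑_{k ∈ ℤ^d} √(n_in(k / L)) η_k(ω) e^{2πi k·x}`, where `n_in : ℝ^d → ℝ` is the
(nonnegative, Schwartz) initial spectrum, `L` the size of the physical torus and
`e^{2πi k·x} = UnitAddTorus.mFourier k x` (Deng–Hani, Forum Math. Pi 9 (2021), (1.2);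
J. Amer. Math. Soc. 36 (2023), (DAT)). The `L^{-d}`-type normalisation of Deng–Hani's Fourier
series on `T^d_L` is absorbed by the rescaling ('?', outline §4.9). Junk: `tsum`, hence `0` when
the family is not summable; it is a.s. absolutely summable as soon as `∑_k √(n_in(k/L)) < ∞`
(e.g. Schwartz `n_in ≥ 0`) and `𝔼|η_k| ≤ 1`. Also `L⁻¹ = 0` for `L = 0` (all modes then sample
`n_in 0`); statements take `L > 0` (indeed `L → ∞`). [claim: DengHaniMa2024, status: under-review] -/
def randomData (L : ℝ) (nin : EuclideanSpace ℝ d → ℝ) (η : (d → ℤ) → Ω → ℂ) (ω : Ω)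
    (x : UnitAddTorus d) : ℂ :=
  ∑' k : d → ℤ, (Real.sqrt (nin (L⁻¹ • FunctionSpaces.Torus.latticeVec k)) : ℂ) * η k ω *
    UnitAddTorus.mFourier k x

omit [DecidableEq d] in
/-- The *mode energy* `𝔼 |û(t, k)|²` of a random time-dependent field `u : Ω → ℝ → T^d → ℂ` at
time `t` and lattice mode `k ∈ ℤ^d`, with `û(t, k) = UnitAddTorus.mFourierCoeff (u ω t) k`; the
quantity that the wave kinetic equation describes in the kinetic limit (Deng–Hani, Forum Math.
Pi 9 (2021), Thm 1.1; J. Amer. Math. Soc. 36 (2023), Thm 1.1). Junk: Bochner integrals. [claim: DengHaniMa2024, status: under-review] -/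
def modeEnergy (P : Measure Ω) (u : Ω → ℝ → UnitAddTorus d → ℂ) (t : ℝ) (k : d → ℤ) : ℝ :=
  ∫ ω, ‖UnitAddTorus.mFourierCoeff (u ω t) k‖ ^ 2 ∂P

/-- The *kinetic (Van Hove) time scale* `T_kin = α⁻²` attached to the nonlinearity strength `α`
of the cubic NLS (Deng–Hani, Forum Math. Pi 9 (2021), (1.4); J. Amer. Math. Soc. 36 (2023),
§1.1: `T_kin ∼ α⁻²`). This is only meaningful in the normalisation of `IsCubicNLSOn` /
`randomData` (mode energies `O(1)`, all `L`-dependence inside `α`); the numerical constant in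
front (e.g. `1/2`) is **not** verified ('?', outline §4.9). Junk: `0⁻¹ = 0` for `α = 0`. [claim: DengHaniMa2024, status: under-review] -/
def kineticTime (α : ℝ) : ℝ :=
  (α ^ 2)⁻¹

/-- The kinetic time `α⁻²` is nonnegative (API lemma; immediate from the definition). [folklore] -/
theorem kineticTime_nonneg (α : ℝ) : 0 ≤ kineticTime α := by
  unfold kineticTime
  positivity

/-- **Initial mode energies of the random data**: if `η` is a random phase family under the
probability measure `P`, `n_in ≥ 0` and `∑_k √(n_in(k/L)) < ∞` (so that `randomData` is a.s. an
absolutely convergent Fourier series), then any random field `u` with `u(ω, 0) = randomData L n_in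
η ω` has `𝔼 |û(0, k)|² = n_in(k / L)` for every mode `k ∈ ℤ^d` (Deng–Hani, Forum Math. Pi 9
(2021), discussion after (1.2): `𝔼 |û_in(k)|² = n_in(k)`). [claim: DengHaniMa2024, status: under-review] -/
def modeEnergy_randomData_zero : Prop :=
  ∀ {P : Measure Ω} [IsProbabilityMeasure P] {η : (d → ℤ) → Ω → ℂ} (hη : IsRandomPhaseFamily P η) {L : ℝ} {nin : EuclideanSpace ℝ d → ℝ} (hnonneg : ∀ v, 0 ≤ nin v) (hsum : Summable fun k : d → ℤ => Real.sqrt (nin (L⁻¹ • FunctionSpaces.Torus.latticeVec k))) {u : Ω → ℝ → UnitAddTorus d → ℂ} (hu : ∀ ω, u ω 0 = randomData L nin η ω) (k : d → ℤ),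
    modeEnergy P u 0 k = nin (L⁻¹ • FunctionSpaces.Torus.latticeVec k)

end Random

end WaveKinetic

end

end Literature.Analysis.FluidPDE
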